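import Literature.NumberTheory.LFunctions.DirichletZeroDensitySevenThirds
import HarnessLib

/-!
# Chen–Gupta–Li (arXiv:2507.08296v2) Theorems 1.1 and 1.2: the «In all cases» displays are the
# case `q₁ = q` of the divisor displays — PROOF file (sibling of the statement file)

Proof-only companion of `DirichletZeroDensitySevenThirds.lean` (p457227, cell `landau-siegel` §C,
HARVEST row T-037): theorems only, no new definitions, no new named facts (D-0014/D-0026, kernel
lane). It records, as kernel-checked implications between the named facts ALREADY typed there, the
bookkeeping by which the paper passes from its divisor-aspect displays to its «In all cases» displays:
the trivial divisor `q₁ = q` is always admissible (`q ∣ q`, and `q ≥ √q`), and at `q₁ = q`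

* Theorem 1.1, first display, becomes the «In all cases» display of Theorem 1.1 on the nose:
  `q·q₁^{−1/2}T^{1/2}N³V^{−4} = (qT)^{1/2}N³V^{−4}` and `q·q₁^{1/3}TN²V^{−4} = q^{4/3}TN²V^{−4}`
  (`theorem11_allCases_of_theorem11`, same constant);
* Theorem 1.2, second display (`q₁ ≥ √q`), becomes
  `(q^{1/3}q²T²)^{1−σ} + (q^{9/4}T^{9/4})^{1−σ} + (qT)^{B(1)(1−σ)} + (qT)^{30(1−σ)/13}` with
  `β = log(q₁T)/log(qT) = 1`; the first term IS the printed `q^{7(1−σ)/3}T^{2(1−σ)}` (this is where the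
  exponent `7/3 = 1/3 + 2` comes from), and the middle two are at most `(qT)^{30(1−σ)/13}` because
  `9/4 = 2.25 ≤ 30/13` and `B(1) = (40 − √160)/12 = 2.2792… ≤ 30/13 = 2.3076…` (`bExponent_one_lt`,
  kernel arithmetic: `(160/13)² = 25600/169 < 160`) while `qT ≥ 1` (at `qT = 1` every power of `qT`
  is `1`) — so the «In all cases» display of Theorem 1.2 follows with constant `3C`
  (`theorem12_allCases_of_largeDivisor`), and with it the `7/3` headline
  (`zeroDensitySevenThirds_of_largeDivisor`, composing the statement file's
  `zeroDensitySevenThirds_of_allCases`).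

Nothing here asserts any of the CGL displays: every theorem is an implication between the typed
`Prop`s (`theorem11 → theorem11_allCases`, `theorem12_largeDivisor → theorem12_allCases →
zeroDensitySevenThirds`). Source read: arXiv v2 TeX l.114–128 (Thm 1.1), l.158–187 (Thm 1.2 and the
sentence «the best exponent … is A = 7/3»), cell excerpt `pub/landau-siegel/lit/typer-1/CGL-V2-EXCERPT.md`
(sha16 b38ca014c8c07c33).

«The programme SEARCHES and TYPES; no claim about Landau–Siegel zeros, Theorems 1–2 of
arXiv:2211.02515 or a repaired Margin232 until a kernel theorem says so.»

## References

* [ChenGuptaLi2025] B. Chen, V. Gupta, Y. C. Li, *Large value estimates for Dirichlet polynomials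
  with characters and zero density of Dirichlet L-functions*, arXiv:2507.08296v2 (2026) —
  Theorem 1.1 (l.114–128), Theorem 1.2 (l.158–186), §1 l.187.
-/

noncomputable section

open scoped Classical

namespace Literature.NumberTheory.LFunctions

namespace ChenGuptaLi2025

open ThornerZaman2024PNTAP (modZeroCount)

/-! ### Theorem 1.1: «In all cases» is the case `q₁ = q` -/

/-- **CGL Theorem 1.1, «In all cases» from the divisor display at `q₁ = q`.** With `q₁ = q` the
two `q₁`-dependent terms of the first display read `q·q^{−1/2}T^{1/2}N³V^{−4} = (qT)^{1/2}N³V^{−4}` and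
`q·q^{1/3}TN²V^{−4} = q^{4/3}TN²V^{−4}`, i.e. exactly the «In all cases» display (same constant
`C(ε)`). [cite: ChenGuptaLi2025, Theorem 1.1 (both displays), arXiv v2 TeX l.114–128] -/
theorem theorem11_allCases_of_theorem11 (h : theorem11) : theorem11_allCases := by
  intro ε hε
  obtain ⟨C, hC⟩ := h ε hε
  refine ⟨C, fun q _ T N V a W hT hN hV ha hW => ?_⟩
  have hq0 : (0 : ℝ) < q := by exact_mod_cast Nat.pos_of_ne_zero (NeZero.ne q)
  have hT0 : (0 : ℝ) ≤ T := by linarith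
  -- `(qT)^{1/2} = q · q^{−1/2} · T^{1/2}`
  have e0 : (q : ℝ) ^ (1 / 2 : ℝ) = (q : ℝ) * (q : ℝ) ^ (-(1 / 2) : ℝ) := by
    have h1 := Real.rpow_add hq0 (1 : ℝ) (-(1 / 2) : ℝ)
    rw [Real.rpow_one, show (1 : ℝ) + (-(1 / 2) : ℝ) = 1 / 2 by norm_num] at h1
    exact h1
  have e1 : ((q : ℝ) * T) ^ (1 / 2 : ℝ) = (q : ℝ) * (q : ℝ) ^ (-(1 / 2) : ℝ) * T ^ (1 / 2 : ℝ) := by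
    rw [Real.mul_rpow hq0.le hT0, e0]
  -- `q^{4/3} = q · q^{1/3}`
  have e2 : (q : ℝ) ^ (4 / 3 : ℝ) = (q : ℝ) * (q : ℝ) ^ (1 / 3 : ℝ) := by
    have h1 := Real.rpow_add hq0 (1 : ℝ) (1 / 3 : ℝ)
    rw [Real.rpow_one, show (1 : ℝ) + (1 / 3 : ℝ) = 4 / 3 by norm_num] at h1
    exact h1
  rw [e1, e2]
  exact hC q q T N V a W dvd_rfl hT hN hV ha hW

/-! ### Theorem 1.2: «In all cases» is the case `q₁ = q ≥ √q` of the second display -/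

/-- The printed exponent at `β = 1` (the value of `β = log(q₁T)/log(qT)` at `q₁ = q`, `qT > 1`):
`B(1) = (37 + 3 − √(9 + 222 − 71))/12 = (40 − √160)/12`.
[cite: ChenGuptaLi2025, Theorem 1.2 (second display, definition of B), arXiv v2 TeX l.171–177] -/
theorem bExponent_one : bExponent 1 = (40 - Real.sqrt 160) / 12 := by
  unfold bExponent
  norm_num

/-- `B(1) = (40 − √160)/12 = 2.2792… < 30/13 = 2.3076…` (as `(160/13)² = 25600/169 < 160`, so
`√160 > 160/13 = 40 − 360/13`): at `q₁ = q` the `(qT)^{B(1−σ)}` term of the second display of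
Theorem 1.2 is dominated by its `(qT)^{30(1−σ)/13}` term.
[cite: ChenGuptaLi2025, Theorem 1.2 (second display vs «In all cases»), arXiv v2 TeX l.171–182] -/
theorem bExponent_one_lt : bExponent 1 < 30 / 13 := by
  rw [bExponent_one]
  have h : (160 / 13 : ℝ) < Real.sqrt 160 := by
    rw [Real.lt_sqrt (by norm_num)]
    norm_num
  linarith

/-- **CGL Theorem 1.2, «In all cases» from the second (large-divisor) display at `q₁ = q`.** The
divisor `q₁ = q` satisfies `q₁ ∣ q` and `q₁ ≥ √q`; the second display then reads
`(q^{1/3}q²T²)^{1−σ} + (q³T^{9/4}q^{−3/4})^{1−σ} + (qT)^{B(β)(1−σ)} + (qT)^{30(1−σ)/13}` with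
`β = log(qT)/log(qT)`. Its first term equals `q^{7(1−σ)/3}T^{2(1−σ)}`; its second is
`(qT)^{9(1−σ)/4} ≤ (qT)^{30(1−σ)/13}`; its third is `(qT)^{B(1)(1−σ)} ≤ (qT)^{30(1−σ)/13}` when `qT > 1`
(`bExponent_one_lt`) and equals `1 = (qT)^{30(1−σ)/13}` when `qT = 1`. Hence the «In all cases»
display holds with constant `3·max(C,0)`.
[cite: ChenGuptaLi2025, Theorem 1.2 (second display and «In all cases»), arXiv v2 TeX l.171–182] -/
theorem theorem12_allCases_of_largeDivisor (h : theorem12_largeDivisor) : theorem12_allCases := by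
  intro ε hε
  obtain ⟨C, hC⟩ := h ε hε
  refine ⟨3 * max C 0, fun q _ T σ hT hσ hσ' => ?_⟩
  have hq1 : (1 : ℝ) ≤ q := by exact_mod_cast Nat.one_le_iff_ne_zero.2 (NeZero.ne q)
  have hq0 : (0 : ℝ) < q := by linarith
  have hT0 : (0 : ℝ) < T := by linarith
  have hqT : (1 : ℝ) ≤ (q : ℝ) * T := one_le_mul_of_one_le_of_one_le hq1 hT
  have hqT0 : (0 : ℝ) ≤ (q : ℝ) * T := by linarith
  have h1σ : 0 < 1 - σ := by linarith
  -- `q₁ = q` is admissible: `√q ≤ q` for `q ≥ 1`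
  have hsqrt : Real.sqrt (q : ℝ) ≤ (q : ℝ) := by
    calc Real.sqrt (q : ℝ) ≤ Real.sqrt ((q : ℝ) ^ 2) := Real.sqrt_le_sqrt (by nlinarith)
      _ = q := Real.sqrt_sq hq0.le
  have key := hC q q T σ dvd_rfl hsqrt hT hσ hσ'
  -- the four terms of the second display at `q₁ = q`
  set A4 : ℝ := ((q : ℝ) * T) ^ (30 * (1 - σ) / 13) with hA4
  set B1 : ℝ := (q : ℝ) ^ (7 * (1 - σ) / 3) * T ^ (2 * (1 - σ)) with hB1
  -- first term `= q^{7(1−σ)/3} T^{2(1−σ)}`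
  have hA1 : ((q : ℝ) ^ (1 / 3 : ℝ) * (q : ℝ) ^ 2 * T ^ 2) ^ (1 - σ) = B1 := by
    have hq73 : (q : ℝ) ^ (1 / 3 : ℝ) * (q : ℝ) ^ 2 = (q : ℝ) ^ (7 / 3 : ℝ) := by
      rw [← Real.rpow_natCast (q : ℝ) 2, ← Real.rpow_add hq0]
      norm_num
    have ex1 : (7 * (1 - σ) / 3 : ℝ) = (7 / 3 : ℝ) * (1 - σ) := by ring
    rw [hB1, hq73, Real.mul_rpow (Real.rpow_nonneg hq0.le _) (by positivity), ← Real.rpow_mul hq0.le,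
      ← Real.rpow_two, ← Real.rpow_mul hT0.le, ex1]
  -- second term `= (qT)^{9(1−σ)/4} ≤ (qT)^{30(1−σ)/13}`
  have hA2 : ((q : ℝ) ^ 3 * T ^ (9 / 4 : ℝ) * (q : ℝ) ^ (-(3 / 4) : ℝ)) ^ (1 - σ) ≤ A4 := by
    have hq94 : (q : ℝ) ^ 3 * T ^ (9 / 4 : ℝ) * (q : ℝ) ^ (-(3 / 4) : ℝ) =
        ((q : ℝ) * T) ^ (9 / 4 : ℝ) := by
      have h3 : (q : ℝ) ^ 3 * (q : ℝ) ^ (-(3 / 4) : ℝ) = (q : ℝ) ^ (9 / 4 : ℝ) := by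
        rw [← Real.rpow_natCast (q : ℝ) 3, ← Real.rpow_add hq0]
        norm_num
      rw [mul_right_comm, h3, Real.mul_rpow hq0.le hT0.le]
    rw [hq94, ← Real.rpow_mul hqT0, hA4]
    exact Real.rpow_le_rpow_of_exponent_le hqT (by nlinarith)
  -- third term `≤ (qT)^{30(1−σ)/13}`
  have hA3 : ((q : ℝ) * T) ^
      (bExponent (Real.log ((q : ℝ) * T) / Real.log ((q : ℝ) * T)) * (1 - σ)) ≤ A4 := by
    rcases hqT.eq_or_lt with heq | hlt
    · rw [← heq, Real.one_rpow, hA4, ← heq, Real.one_rpow]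
    · have hlog : Real.log ((q : ℝ) * T) ≠ 0 := (Real.log_pos hlt).ne'
      rw [div_self hlog, hA4]
      refine Real.rpow_le_rpow_of_exponent_le hqT ?_
      have hb := mul_le_mul_of_nonneg_right bExponent_one_lt.le h1σ.le
      calc bExponent 1 * (1 - σ) ≤ 30 / 13 * (1 - σ) := hb
        _ = 30 * (1 - σ) / 13 := by ring
  -- assemble
  have hS : ((q : ℝ) ^ (1 / 3 : ℝ) * (q : ℝ) ^ 2 * T ^ 2) ^ (1 - σ) +
        ((q : ℝ) ^ 3 * T ^ (9 / 4 : ℝ) * (q : ℝ) ^ (-(3 / 4) : ℝ)) ^ (1 - σ) +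
        ((q : ℝ) * T) ^ (bExponent (Real.log ((q : ℝ) * T) / Real.log ((q : ℝ) * T)) * (1 - σ)) +
        A4 ≤ 3 * (B1 + A4) := by
    have hB1' : 0 ≤ B1 := by rw [hB1]; positivity
    rw [hA1]
    linarith
  have hSpos : 0 ≤ ((q : ℝ) ^ (1 / 3 : ℝ) * (q : ℝ) ^ 2 * T ^ 2) ^ (1 - σ) +
        ((q : ℝ) ^ 3 * T ^ (9 / 4 : ℝ) * (q : ℝ) ^ (-(3 / 4) : ℝ)) ^ (1 - σ) +
        ((q : ℝ) * T) ^ (bExponent (Real.log ((q : ℝ) * T) / Real.log ((q : ℝ) * T)) * (1 - σ)) +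
        A4 := by positivity
  have hε0 : 0 ≤ ((q : ℝ) * T) ^ ε := Real.rpow_nonneg hqT0 _
  calc (modZeroCount q σ T : ℝ)
      ≤ C * ((q : ℝ) * T) ^ ε * _ := key
    _ ≤ max C 0 * ((q : ℝ) * T) ^ ε * _ :=
        mul_le_mul_of_nonneg_right (mul_le_mul_of_nonneg_right (le_max_left _ _) hε0) hSpos
    _ ≤ max C 0 * ((q : ℝ) * T) ^ ε * (3 * (B1 + A4)) :=
        mul_le_mul_of_nonneg_left hS (mul_nonneg (le_max_right _ _) hε0)
    _ = 3 * max C 0 * ((q : ℝ) * T) ^ ε * (B1 + A4) := by ring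

/-- **The `7/3` headline from the second display of Theorem 1.2** (via «In all cases»):
`theorem12_largeDivisor → zeroDensitySevenThirds`, composing `theorem12_allCases_of_largeDivisor`
with the statement file's `zeroDensitySevenThirds_of_allCases`.
[cite: ChenGuptaLi2025, Abstract and §1 l.187 («the best exponent … is A = 7/3»)] -/
theorem zeroDensitySevenThirds_of_largeDivisor (h : theorem12_largeDivisor) :
    zeroDensitySevenThirds :=
  zeroDensitySevenThirds_of_allCases (theorem12_allCases_of_largeDivisor h)

end ChenGuptaLi2025

end Literature.NumberTheory.LFunctions
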